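import Summits.RiemannHypothesis.RiemannHypothesis.Theorems.SignConeSignConeOscillatoryEnvelope
import Summits.RiemannHypothesis.RiemannHypothesis.Theorems.SignConeSignConeOscillatoryTwoBump

/-!
# The oscillatory crux is the whole sign-cone inequality
(route `SignCone`, item stmt-RiemannHypothesis-16302 `SignConeOscillatory`)

`SignConeOscillatory → SignConeInequality`, hence `SignConeOscillatory ↔ SignConeInequality` (the route's TARGET,
item stmt-RiemannHypothesis-16301) and `SignConeOscillatory → SignConeFarField` (item stmt-RiemannHypothesis-16305).

The route splits the unit-slack sign-cone inequality `-Re F(0) ≤ Re W_ar(F)` on node-nonnegative `F = Σᵢ gᵢ ⋆ g̃ᵢ`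
by the sign of `Re F` beyond the first node: `SignConeFarField` (`Re F ≥ 0` on `|t| ≥ log 2`) and
`SignConeOscillatory` (`Re F(t) < 0` for some `|t| ≥ log 2`). Because both statements quantify over ALL cutoffs
`a`, the oscillation hypothesis carries no information: given any node-nonnegative `F ∈ P(a)`, append one more
summand, a two-bump test `w = φ(· + c/2) - φ(· - c/2)` (`φ` a smooth bump of tiny radius `ρ`) whose
autocorrelation `G = w ⋆ w̃ = 2Φ - Φ(· - c) - Φ(· + c)` is placed in a node gap BEYOND the support of `F`:
`c = (log n + log (n+1))/2` with `log n > 2a`. Then for every `η > 0` the kernel `F + η² G` lies in the cone at the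
larger cutoff `a' = c/2 + ρ`, is node-nonnegative (`G(log m) = 0` for all `m ≥ 2`), and is oscillatory
(`Re (F + η² G)(c) = -η² ∫ φ² < 0`, as `F(c) = 0` for `c > 2a`). The crux at cutoff `a'` and linearity of
`W_ar = weilPolarTerm + weilArchTerm` give `-Re F(0) - η² Re G(0) ≤ Re W_ar(F) + η² Re W_ar(G)` for every
`η > 0`, and `η → 0` yields the inequality for `F`.

Consequences for the route: the crux `SignConeOscillatory` is EQUIVALENT to the target `SignConeInequality`
(so it is exactly as strong as the target — RH-strength by the route's own duality + magnification cruxes), the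
support item `SignConeFarField` is a COROLLARY of the crux, and the deciding theorem `closes` uses its fourth
hypothesis redundantly (`closes h₁ h₂ h₃ (signConeFarField_of_signConeOscillatory h₁)`). A split of the sign
cone that isolates
genuinely oscillatory tests must quantify the depth of the oscillation relative to `F(0)` (or pin the cutoff to
the support); the plain sign dichotomy does not.
-/

noncomputable section

-- `Summit.RiemannHypothesis.RiemannHypothesis.…` repeats a namespace component by design (D-0017 layout).
set_option linter.dupNamespace false

open scoped BigOperators ComplexConjugate Topology
open Complex MeasureTheory Set Filter

namespace Summit.RiemannHypothesis.RiemannHypothesis.Theorems.SignCone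

open Literature.NumberTheory.LFunctions
open Summit.RiemannHypothesis.RiemannHypothesis.Theorems.RuelleBandCofiniteCriticalLine
open Summit.RiemannHypothesis.RiemannHypothesis.Theses.SignCone

/-! ## The limit `η → 0` -/

/-- `x ≤ y` as soon as `x ≤ y + η² K` for every `η > 0`. [folklore] -/
theorem le_of_forall_pos_le_add_sq_mul {x y K : ℝ} (h : ∀ η : ℝ, 0 < η → x ≤ y + η ^ 2 * K) : x ≤ y := by
  by_contra hxy
  push Not at hxy
  have hdpos : 0 < x - y := by linarith
  have hKpos : 0 < 2 * (|K| + 1) := by positivity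
  set η := Real.sqrt ((x - y) / (2 * (|K| + 1))) with hη
  have hηpos : 0 < η := Real.sqrt_pos.2 (by positivity)
  have hη2 : η ^ 2 = (x - y) / (2 * (|K| + 1)) := Real.sq_sqrt (by positivity)
  have h1 := h η hηpos
  rw [hη2] at h1
  have h3 : (x - y) / (2 * (|K| + 1)) * K ≤ (x - y) / (2 * (|K| + 1)) * |K| :=
    mul_le_mul_of_nonneg_left (le_abs_self K) (by positivity)
  have h4 : (x - y) / (2 * (|K| + 1)) * |K| ≤ (x - y) / 2 := by
    rw [div_mul_eq_mul_div, div_le_div_iff₀ hKpos (by norm_num : (0 : ℝ) < 2)]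
    nlinarith [abs_nonneg K]
  linarith

/-! ## The main theorem -/

/-- **`SignConeOscillatory → SignConeInequality`.** The oscillatory crux implies the whole unit-slack sign-cone
inequality (the route's target): given a node-nonnegative `F = Σᵢ gᵢ ⋆ g̃ᵢ` at cutoff `a`, the family
`F + η² (w ⋆ w̃)` (`w` the two-bump witness in a node gap beyond `2a`, cutoff `a' = c/2 + ρ ≥ a`) is
node-nonnegative and oscillatory for every `η > 0`; the crux at `a'`, linearity of
`weilPolarTerm + weilArchTerm`, and `η → 0` give the inequality for `F`. [folklore] -/
theorem signConeInequality_of_signConeOscillatory (h : SignConeOscillatory) : SignConeInequality := by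
  intro a ha k g hg F hn M
  have hFdef : F = fun t => ∑ i, weilConv (g i) (weilReflect (g i)) t := rfl
  have hgi : ∀ i, IsWeilTest (g i) := fun i => (hg i).1
  have hFt : IsWeilTest F := by
    rw [hFdef]
    exact stub_branchesContinuous_isWeilTest_sum _ fun i _ => (hgi i).weilConv (hgi i).weilReflect
  -- parameters and the witness
  obtain ⟨N, c, hc2a, hc2, hρc, hnode, hlogm⟩ := exists_gap_parameters ha
  have hρ := (WeilContinuous.bump N).rOut_pos
  have hc0 : 0 ≤ c := by linarith
  set ρ := (WeilContinuous.bump N).rOut with hρdef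
  set w : ℝ → ℂ := fun u => WeilContinuous.moll N (u + c / 2) - WeilContinuous.moll N (u - c / 2)
    with hwdef
  set G : ℝ → ℂ := weilConv w (weilReflect w) with hGdef
  have hwt : IsWeilTest w := isWeilTest_twoBump N c
  have hwsupp : tsupport w ⊆ Icc (-(c / 2 + ρ)) (c / 2 + ρ) := tsupport_twoBump_subset N hc0
  have hGt : IsWeilTest G := hwt.weilConv hwt.weilReflect
  have hGnode : ∀ m : ℕ, 2 ≤ m → G (Real.log m) = 0 := fun m hm =>
    weilConv_twoBump_eq_zero N hc0 (hlogm m hm) (hnode m hm)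
  have hGc : (G c).re < 0 := re_weilConv_twoBump_neg N hρc
  -- `F` vanishes at `c > 2a`
  have hFc : F c = 0 := by
    show (∑ i, weilConv (g i) (weilReflect (g i)) c) = 0
    refine Finset.sum_eq_zero fun i _ => ?_
    have hsub := tsupport_weilConv_weilReflect_subset (hgi i).2 (hg i).2
    refine image_eq_zero_of_notMem_tsupport fun hmem => ?_
    have := hsub hmem
    rw [mem_Icc] at this
    linarith [this.2]
  -- the key inequality for every `η > 0`
  have key : ∀ η : ℝ, 0 < η →
      -(F 0).re ≤ (weilPolarTerm F + weilArchTerm F).re +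
        η ^ 2 * ((weilPolarTerm G + weilArchTerm G).re + (G 0).re) := by
    intro η hη
    set a' : ℝ := c / 2 + ρ with ha'def
    have ha' : 0 < a' := by rw [ha'def]; linarith
    have haa' : a ≤ a' := by rw [ha'def]; linarith
    set wη : ℝ → ℂ := fun u => (η : ℂ) * w u with hwηdef
    have hwηt : IsWeilTest wη := hwt.const_mul (η : ℂ)
    have hwηsupp : tsupport wη ⊆ Icc (-a') a' := tsupport_mul_subset_right.trans hwsupp
    set g' : Fin (k + 1) → ℝ → ℂ := Fin.snoc (α := fun _ => ℝ → ℂ) g wη with hg'def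
    have hg'c : ∀ i : Fin k, g' (Fin.castSucc i) = g i := fun i => by simp [hg'def]
    have hg'l : g' (Fin.last k) = wη := by simp [hg'def]
    have hF' : (fun t => ∑ i, weilConv (g' i) (weilReflect (g' i)) t) =
        fun t => F t + ((η ^ 2 : ℝ) : ℂ) * G t := by
      funext t
      rw [Fin.sum_univ_castSucc]
      simp only [hg'c, hg'l, hFdef]
      rw [hwηdef, weilConv_weilReflect_real_mul]
    have hF't : ∀ t, ∑ i, weilConv (g' i) (weilReflect (g' i)) t = F t + ((η ^ 2 : ℝ) : ℂ) * G t :=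
      fun t => congrFun hF' t
    have hg' : ∀ i, (ContDiff ℝ ((⊤ : ℕ∞) : WithTop ℕ∞) (g' i) ∧ HasCompactSupport (g' i)) ∧
        tsupport (g' i) ⊆ Set.Icc (-a') a' := by
      intro i
      induction i using Fin.lastCases with
      | last =>
        rw [hg'l]
        exact ⟨hwηt, hwηsupp⟩
      | cast j =>
        rw [hg'c]
        exact ⟨(hg j).1, (hg j).2.trans (Icc_subset_Icc (by linarith) haa')⟩
    have hn' : ∀ m : ℕ, 2 ≤ m →
        0 ≤ ((fun t => ∑ i, weilConv (g' i) (weilReflect (g' i)) t) (Real.log m)).re := by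
      intro m hm
      show 0 ≤ (∑ i, weilConv (g' i) (weilReflect (g' i)) (Real.log m)).re
      rw [hF't, hGnode m hm, mul_zero, add_zero]
      exact hn m hm
    have hosc' : ∃ t : ℝ, Real.log 2 ≤ |t| ∧
        ((fun t => ∑ i, weilConv (g' i) (weilReflect (g' i)) t) t).re < 0 := by
      refine ⟨c, by rwa [abs_of_nonneg hc0], ?_⟩
      show (∑ i, weilConv (g' i) (weilReflect (g' i)) c).re < 0
      rw [hF't, hFc, zero_add, Complex.re_ofReal_mul]
      exact mul_neg_of_pos_of_neg (pow_pos hη 2) hGc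
    have step : -((fun t => ∑ i, weilConv (g' i) (weilReflect (g' i)) t) 0).re ≤
        (weilPolarTerm (fun t => ∑ i, weilConv (g' i) (weilReflect (g' i)) t) +
          weilArchTerm (fun t => ∑ i, weilConv (g' i) (weilReflect (g' i)) t)).re :=
      h a' ha' (k + 1) g' hg' hn' hosc'
    rw [hF', weilArchPolar_add_const_mul hFt hGt] at step
    simp only [Complex.add_re, Complex.re_ofReal_mul] at step
    simp only [Complex.add_re]
    linear_combination step
  have hmain : -(F 0).re ≤ (weilPolarTerm F + weilArchTerm F).re :=
    le_of_forall_pos_le_add_sq_mul key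
  exact hmain

/-- **The crux is the target**: `SignConeOscillatory ↔ SignConeInequality`. [folklore] -/
theorem signConeOscillatory_iff_signConeInequality : SignConeOscillatory ↔ SignConeInequality :=
  ⟨signConeInequality_of_signConeOscillatory, signConeOscillatory_of_signConeInequality⟩

/-- **The far-field item is a corollary of the crux**: `SignConeOscillatory → SignConeFarField`. [folklore] -/
theorem signConeFarField_of_signConeOscillatory (h : SignConeOscillatory) : SignConeFarField :=
  signConeFarField_of_signConeInequality (signConeInequality_of_signConeOscillatory h)

end Summit.RiemannHypothesis.RiemannHypothesis.Theorems.SignCone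

end
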